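import Mathlib
import Literature.Computability.QuantumComplexity.PauliParseval
import Literature.Computability.Cryptography.QubitRegister
import Summits.QuantumAdvantage.QuantumAdvantage.Theorems.SymplecticPuritySymplecticPurityBoundPauli
import Summits.QuantumAdvantage.QuantumAdvantage.Theorems.SymplecticPuritySymplecticPurityBoundKernel
import Summits.QuantumAdvantage.QuantumAdvantage.Theorems.SymplecticPuritySymplecticPurityBoundTensor

/-!
# Route SymplecticPurity · item SymplecticPurityBound — the stabilizer counting (helper file 4/5)

Fix a semantic Clifford unitary `U` on `n + m` wires with label map `f` (`U σ_S U† = c(S) σ_{f S}`),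
and for a wire set `A` put (all as plain expressions, no definitions)

* `a(A) = #{R ∈ {I,Z}^m : f(I^n ⊗ R) ∈ 𝒫_A}` — the stabilizers of `U(· ⊗ |0^m⟩)` supported in `A`;
* `b(A) = #{T : f T ∈ 𝒫_A, T|anc ∈ {I,Z}^m}`.

We prove the two counting facts of the purity bound:

* **(ii) duality** `2^m · b(A) = 4^{|A|} · a(Aᶜ)` — by evaluating the double character sum
  `Σ_{f T ∈ 𝒫_A} Σ_{z ∈ I^n⊗{I,Z}^m} sgn(T,z)` in the two orders (the inner sums are the product
  formulas of the Kernel file; `f` enters only through bijectivity and sign preservation);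
* **(i) isotropy** `a(A) · a(Aᶜ) ≤ 2^m` — `(R, R') ↦ R·R'` is injective on the pairs counted,
  because `f(z z') = f(z) f(z')` has `f z` on `A` and `f z'` off `A`;

and combine them with the spectral-mass identity and the data/ancilla factorisation into the
**cut bound** `Tr ρ_A² ≤ u + ε²/u`, `u = a(A)/2^{|A|}`.
-/

noncomputable section

set_option linter.dupNamespace false -- D-0017: single-problem summit ⇒ `QuantumAdvantage.QuantumAdvantage` by design

open Matrix Finset
open Literature.Computability.QuantumComplexity Literature.Computability.Cryptography

namespace Summit.QuantumAdvantage.QuantumAdvantage.Theorems.SymplecticPurity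

variable {n m : ℕ} {U : Matrix (Fin (n + m) → Bool) (Fin (n + m) → Bool) ℂ}
  {f : (Fin (n + m) → Pauli) → (Fin (n + m) → Pauli)} {c : (Fin (n + m) → Pauli) → ℂ}

/-! ## The embedded diagonal strings `I^n ⊗ R` -/

/-- Letters of a member of `{I,Z}^m`. -/
theorem letter_of_mem_piFinset_IZ {R : Fin m → Pauli}
    (hR : R ∈ Fintype.piFinset (fun _ : Fin m => ({Pauli.I, Pauli.Z} : Finset Pauli))) (j : Fin m) :
    R j = Pauli.I ∨ R j = Pauli.Z := by
  have h := Fintype.mem_piFinset.1 hR j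
  simpa only [Finset.mem_insert, Finset.mem_singleton] using h

/-- Membership in `{I,Z}^m` from the letters. -/
theorem mem_piFinset_IZ_of_letter {R : Fin m → Pauli} (hR : ∀ j, R j = Pauli.I ∨ R j = Pauli.Z) :
    R ∈ Fintype.piFinset (fun _ : Fin m => ({Pauli.I, Pauli.Z} : Finset Pauli)) := by
  rw [Fintype.mem_piFinset]
  intro j
  simpa only [Finset.mem_insert, Finset.mem_singleton] using hR j

/-- The letters of `I^n ⊗ R` are diagonal when those of `R` are. -/
theorem append_I_letter {R : Fin m → Pauli} (hR : ∀ j, R j = Pauli.I ∨ R j = Pauli.Z)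
    (i : Fin (n + m)) :
    Fin.append (fun _ : Fin n => Pauli.I) R i = Pauli.I ∨
      Fin.append (fun _ : Fin n => Pauli.I) R i = Pauli.Z := by
  refine Fin.addCases (fun i => ?_) (fun j => ?_) i
  · left; rw [Fin.append_left]
  · rw [Fin.append_right]; exact hR j

/-- `I^n ⊗ I^m = I^{n+m}`. -/
theorem append_I_I : Fin.append (fun _ : Fin n => Pauli.I) (fun _ : Fin m => Pauli.I) =
    fun _ => Pauli.I := by
  funext i
  refine Fin.addCases (fun i => ?_) (fun j => ?_) i
  · rw [Fin.append_left]
  · rw [Fin.append_right]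

/-- `R ↦ I^n ⊗ R` is injective. -/
theorem append_I_injective : Function.Injective
    (fun R : Fin m → Pauli => Fin.append (fun _ : Fin n => Pauli.I) R) := by
  intro R R' h
  funext j
  have := congrFun h (Fin.natAdd n j)
  simpa only [Fin.append_right] using this

/-- `#{I,Z}^m = 2^m`. -/
theorem card_piFinset_IZ :
    (Fintype.piFinset (fun _ : Fin m => ({Pauli.I, Pauli.Z} : Finset Pauli))).card = 2 ^ m := by
  rw [Fintype.card_piFinset, Finset.prod_const, Finset.card_univ, Fintype.card_fin,
    Finset.card_pair (by decide)]

/-! ## Linking the two descriptions of the stabilizer count -/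

/-- The strings `T` with `f T ∈ 𝒫_A`, identity data part and diagonal ancilla part are exactly the
`I^n ⊗ R` with `R ∈ {I,Z}^m` and `f(I^n ⊗ R) ∈ 𝒫_A`; in particular the two counts agree. -/
theorem card_filter_data_anc_eq (A : Finset (Fin (n + m))) :
    ((Finset.univ.filter fun T : Fin (n + m) → Pauli => f T ∈ stringsOn A).filter fun T =>
        (∀ i : Fin n, T (Fin.castAdd m i) = Pauli.I) ∧
          (∀ j : Fin m, T (Fin.natAdd n j) = Pauli.I ∨ T (Fin.natAdd n j) = Pauli.Z)).card =
      ((Fintype.piFinset (fun _ : Fin m => ({Pauli.I, Pauli.Z} : Finset Pauli))).filter fun R =>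
        f (Fin.append (fun _ : Fin n => Pauli.I) R) ∈ stringsOn A).card := by
  symm
  refine Finset.card_bij (fun R _ => Fin.append (fun _ : Fin n => Pauli.I) R) ?_ ?_ ?_
  · intro R hR
    rw [Finset.mem_filter] at hR
    simp only [Finset.mem_filter, Finset.mem_univ, true_and, Fin.append_left, Fin.append_right]
    exact ⟨hR.2, fun _ => trivial, letter_of_mem_piFinset_IZ hR.1⟩
  · intro R₁ _ R₂ _ h
    exact append_I_injective h
  · intro T hT
    simp only [Finset.mem_filter, Finset.mem_univ, true_and] at hT
    refine ⟨fun j => T (Fin.natAdd n j), ?_, ?_⟩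
    · rw [Finset.mem_filter]
      have hT' : Fin.append (fun _ : Fin n => Pauli.I) (fun j => T (Fin.natAdd n j)) = T := by
        conv_rhs => rw [← Fin.append_castAdd_natAdd (f := T)]
        congr 1
        funext i
        exact (hT.2.1 i).symm
      refine ⟨mem_piFinset_IZ_of_letter hT.2.2, ?_⟩
      rw [hT']
      exact hT.1
    · conv_rhs => rw [← Fin.append_castAdd_natAdd (f := T)]
      congr 1
      funext i
      exact (hT.2.1 i).symm

/-! ## (ii) Duality by double counting -/

/-- **Duality count**: `2^m · b(A) = 4^{|A|} · a(Aᶜ)`. -/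
theorem two_pow_mul_card_anc_eq (hU : Uᴴ * U = 1)
    (hf : ∀ S, ‖c S‖ = 1 ∧ U * pauliString S * Uᴴ = c S • pauliString (f S))
    (A : Finset (Fin (n + m))) :
    2 ^ m * ((Finset.univ.filter fun T : Fin (n + m) → Pauli => f T ∈ stringsOn A).filter fun T =>
        ∀ j : Fin m, T (Fin.natAdd n j) = Pauli.I ∨ T (Fin.natAdd n j) = Pauli.Z).card =
      4 ^ A.card * ((Fintype.piFinset (fun _ : Fin m => ({Pauli.I, Pauli.Z} : Finset Pauli))).filter
        fun R => f (Fin.append (fun _ : Fin n => Pauli.I) R) ∈ stringsOn Aᶜ).card := by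
  -- the double character sum, evaluated in the two orders
  set D : ℂ := ∑ T ∈ Finset.univ.filter (fun T : Fin (n + m) → Pauli => f T ∈ stringsOn A),
    ∑ R ∈ Fintype.piFinset (fun _ : Fin m => ({Pauli.I, Pauli.Z} : Finset Pauli)),
      ∏ i, Pauli.sign (T i) (Fin.append (fun _ : Fin n => Pauli.I) R i) with hD
  -- first order: inner sum over the diagonal strings
  have h1 : D = 2 ^ m * (((Finset.univ.filter fun T : Fin (n + m) → Pauli =>
      f T ∈ stringsOn A).filter fun T =>
        ∀ j : Fin m, T (Fin.natAdd n j) = Pauli.I ∨ T (Fin.natAdd n j) = Pauli.Z).card : ℂ) := by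
    rw [hD]
    simp only [sum_piFinset_IZ_prod_sign]
    rw [← Finset.sum_filter, Finset.sum_const, nsmul_eq_mul, mul_comm]
  -- second order: inner sum over `f⁻¹(𝒫_A)`, transported along `f`
  have h2 : D = 4 ^ A.card * (((Fintype.piFinset
      (fun _ : Fin m => ({Pauli.I, Pauli.Z} : Finset Pauli))).filter
        fun R => f (Fin.append (fun _ : Fin n => Pauli.I) R) ∈ stringsOn Aᶜ).card : ℂ) := by
    rw [hD, Finset.sum_comm]
    have inner : ∀ R : Fin m → Pauli,
        ∑ T ∈ Finset.univ.filter (fun T : Fin (n + m) → Pauli => f T ∈ stringsOn A),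
          ∏ i, Pauli.sign (T i) (Fin.append (fun _ : Fin n => Pauli.I) R i) =
        if f (Fin.append (fun _ : Fin n => Pauli.I) R) ∈ stringsOn Aᶜ then (4 : ℂ) ^ A.card
        else 0 := by
      intro R
      have hs : ∀ T : Fin (n + m) → Pauli,
          ∏ i, Pauli.sign (T i) (Fin.append (fun _ : Fin n => Pauli.I) R i) =
            ∏ i, Pauli.sign (f T i) (f (Fin.append (fun _ : Fin n => Pauli.I) R) i) :=
        fun T => (clifford_sign hU hf T _).symm
      simp only [hs]
      rw [sum_filter_comp_clifford hU hf (stringsOn A)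
        (fun Q => ∏ i, Pauli.sign (Q i) (f (Fin.append (fun _ : Fin n => Pauli.I) R) i)),
        sum_stringsOn_prod_sign]
      have hiff : (∀ i ∈ A, f (Fin.append (fun _ : Fin n => Pauli.I) R) i = Pauli.I) ↔
          f (Fin.append (fun _ : Fin n => Pauli.I) R) ∈ stringsOn Aᶜ := by
        rw [mem_stringsOn]
        refine forall_congr' fun i => ?_
        rw [Finset.mem_compl, not_not]
      by_cases h : ∀ i ∈ A, f (Fin.append (fun _ : Fin n => Pauli.I) R) i = Pauli.I
      · rw [if_pos h, if_pos (hiff.1 h)]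
      · rw [if_neg h, if_neg (fun h' => h (hiff.2 h'))]
    simp only [inner]
    rw [← Finset.sum_filter, Finset.sum_const, nsmul_eq_mul, mul_comm]
  have h12 := h1.symm.trans h2
  exact_mod_cast h12

/-! ## (i) Isotropy by an injection -/

/-- **Isotropy count**: `a(A) · a(Aᶜ) ≤ 2^m`. -/
theorem card_mul_card_compl_le (hU : Uᴴ * U = 1)
    (hf : ∀ S, ‖c S‖ = 1 ∧ U * pauliString S * Uᴴ = c S • pauliString (f S))
    (A : Finset (Fin (n + m))) :
    ((Fintype.piFinset (fun _ : Fin m => ({Pauli.I, Pauli.Z} : Finset Pauli))).filter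
        fun R => f (Fin.append (fun _ : Fin n => Pauli.I) R) ∈ stringsOn A).card *
      ((Fintype.piFinset (fun _ : Fin m => ({Pauli.I, Pauli.Z} : Finset Pauli))).filter
        fun R => f (Fin.append (fun _ : Fin n => Pauli.I) R) ∈ stringsOn Aᶜ).card ≤ 2 ^ m := by
  rw [← Finset.card_product, ← card_piFinset_IZ (m := m)]
  refine Finset.card_le_card_of_injOn (fun p j => if p.1 j = p.2 j then Pauli.I else Pauli.Z)
    ?_ ?_
  · intro p _
    simp only [Finset.mem_coe]
    exact mem_piFinset_IZ_of_letter fun j => by by_cases h : p.1 j = p.2 j <;> simp [h]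
  · rintro ⟨R₁, R₁'⟩ h₁ ⟨R₂, R₂'⟩ h₂ h
    simp only [Finset.coe_product, Set.mem_prod, Finset.mem_coe, Finset.mem_filter] at h₁ h₂
    -- embedded versions
    have hz : ∀ {R : Fin m → Pauli},
        R ∈ Fintype.piFinset (fun _ : Fin m => ({Pauli.I, Pauli.Z} : Finset Pauli)) →
        ∀ i, Fin.append (fun _ : Fin n => Pauli.I) R i = Pauli.I ∨
          Fin.append (fun _ : Fin n => Pauli.I) R i = Pauli.Z :=
      fun hR => append_I_letter (letter_of_mem_piFinset_IZ hR)
    have hmerge : ∀ R R' : Fin m → Pauli,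
        (fun i => if Fin.append (fun _ : Fin n => Pauli.I) R i =
            Fin.append (fun _ : Fin n => Pauli.I) R' i then Pauli.I else Pauli.Z) =
          Fin.append (fun _ : Fin n => Pauli.I) (fun j => if R j = R' j then Pauli.I else Pauli.Z) := by
      intro R R'
      funext i
      refine Fin.addCases (fun i => ?_) (fun j => ?_) i
      · simp only [Fin.append_left, if_true]
      · simp only [Fin.append_right]
    have key₁ := clifford_map_mul_of_IZ hU hf (hz h₁.1.1) (hz h₁.2.1) h₁.1.2 h₁.2.2
    have key₂ := clifford_map_mul_of_IZ hU hf (hz h₂.1.1) (hz h₂.2.1) h₂.1.2 h₂.2.2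
    rw [hmerge] at key₁ key₂
    have hRR : (fun j => if R₁ j = R₁' j then Pauli.I else Pauli.Z) =
        fun j => if R₂ j = R₂' j then Pauli.I else Pauli.Z := h
    rw [hRR, key₂] at key₁
    -- key₁ : merge of (f z₂, f z₂') = merge of (f z₁, f z₁')
    have hinj := clifford_injective hU hf
    have e1 : f (Fin.append (fun _ : Fin n => Pauli.I) R₁) =
        f (Fin.append (fun _ : Fin n => Pauli.I) R₂) := by
      funext i
      by_cases hi : i ∈ A
      · have := congrFun key₁ i
        simp only [hi, if_true] at this
        exact this.symm
      · rw [mem_stringsOn.1 h₁.1.2 i hi, mem_stringsOn.1 h₂.1.2 i hi]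
    have e2 : f (Fin.append (fun _ : Fin n => Pauli.I) R₁') =
        f (Fin.append (fun _ : Fin n => Pauli.I) R₂') := by
      funext i
      by_cases hi : i ∈ A
      · have hi' : i ∉ Aᶜ := fun h => (Finset.mem_compl.1 h) hi
        rw [mem_stringsOn.1 h₁.2.2 i hi', mem_stringsOn.1 h₂.2.2 i hi']
      · have := congrFun key₁ i
        simp only [hi, if_false] at this
        exact this.symm
    have r1 := append_I_injective (hinj e1)
    have r2 := append_I_injective (hinj e2)
    rw [r1, r2]

/-! ## The cut bound -/

/-- `a(A) ≥ 1`: the identity is a stabilizer supported everywhere. -/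
theorem one_le_card_stab (hU' : U * Uᴴ = 1)
    (hf : ∀ S, ‖c S‖ = 1 ∧ U * pauliString S * Uᴴ = c S • pauliString (f S))
    (A : Finset (Fin (n + m))) :
    1 ≤ ((Fintype.piFinset (fun _ : Fin m => ({Pauli.I, Pauli.Z} : Finset Pauli))).filter
        fun R => f (Fin.append (fun _ : Fin n => Pauli.I) R) ∈ stringsOn A).card := by
  rw [Nat.one_le_iff_ne_zero, Ne, Finset.card_eq_zero, ← Ne, ← Finset.nonempty_iff_ne_empty]
  refine ⟨fun _ => Pauli.I, ?_⟩
  rw [Finset.mem_filter]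
  refine ⟨mem_piFinset_IZ_of_letter fun _ => Or.inl rfl, ?_⟩
  rw [append_I_I, clifford_map_I hU' hf]
  exact mem_stringsOn.2 fun _ _ => rfl

/-- **The cut bound**: for a unit `ε`-flat `ψ`, a semantic Clifford unitary `U` and a wire set
`A`, the purity `Tr ρ_A²` of `U(ψ ⊗ |0^m⟩)` (four-fold agreement sum) is at most `u + ε²/u` with
`u = a(A)/2^{|A|}`. -/
theorem fourFold_le_stab (hU : Uᴴ * U = 1) (hU' : U * Uᴴ = 1)
    (hf : ∀ S, ‖c S‖ = 1 ∧ U * pauliString S * Uᴴ = c S • pauliString (f S))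
    (ε : ℝ) {ψ : (Fin n → Bool) → ℂ} (hψ : normSq ψ = 1)
    (hflat : ∀ S : Fin n → Pauli, S ≠ (fun _ => Pauli.I) →
      ‖star ψ ⬝ᵥ (pauliString S *ᵥ ψ)‖ ≤ ε)
    (A : Finset (Fin (n + m)))
    [D : ∀ x₁ x₂ x₃ x₄ : Fin (n + m) → Bool, Decidable ((∀ i ∉ A, x₁ i = x₂ i) ∧
      (∀ i ∈ A, x₂ i = x₃ i) ∧ (∀ i ∉ A, x₃ i = x₄ i) ∧ (∀ i ∈ A, x₄ i = x₁ i))] :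
    ‖∑ x₁ : Fin (n + m) → Bool, ∑ x₂ : Fin (n + m) → Bool, ∑ x₃ : Fin (n + m) → Bool,
        ∑ x₄ : Fin (n + m) → Bool,
        (if (∀ i ∉ A, x₁ i = x₂ i) ∧ (∀ i ∈ A, x₂ i = x₃ i) ∧ (∀ i ∉ A, x₃ i = x₄ i) ∧
            (∀ i ∈ A, x₄ i = x₁ i)
         then (U *ᵥ tensorVec ψ (zeroState m)) x₁ * star ((U *ᵥ tensorVec ψ (zeroState m)) x₂) *
           (U *ᵥ tensorVec ψ (zeroState m)) x₃ * star ((U *ᵥ tensorVec ψ (zeroState m)) x₄)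
         else 0)‖ ≤
      (((Fintype.piFinset (fun _ : Fin m => ({Pauli.I, Pauli.Z} : Finset Pauli))).filter
          fun R => f (Fin.append (fun _ : Fin n => Pauli.I) R) ∈ stringsOn A).card : ℝ) / 2 ^ A.card +
      ε ^ 2 * (2 ^ A.card / ((Fintype.piFinset (fun _ : Fin m => ({Pauli.I, Pauli.Z} : Finset Pauli))).filter
          fun R => f (Fin.append (fun _ : Fin n => Pauli.I) R) ∈ stringsOn A).card) := by
  -- abbreviations
  set a : ℕ := ((Fintype.piFinset (fun _ : Fin m => ({Pauli.I, Pauli.Z} : Finset Pauli))).filter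
    fun R => f (Fin.append (fun _ : Fin n => Pauli.I) R) ∈ stringsOn A).card with ha
  set a' : ℕ := ((Fintype.piFinset (fun _ : Fin m => ({Pauli.I, Pauli.Z} : Finset Pauli))).filter
    fun R => f (Fin.append (fun _ : Fin n => Pauli.I) R) ∈ stringsOn Aᶜ).card with ha'
  set b : ℕ := ((Finset.univ.filter fun T : Fin (n + m) → Pauli => f T ∈ stringsOn A).filter
    fun T => ∀ j : Fin m, T (Fin.natAdd n j) = Pauli.I ∨ T (Fin.natAdd n j) = Pauli.Z).card with hb
  have hii : 2 ^ m * b = 4 ^ A.card * a' := two_pow_mul_card_anc_eq hU hf A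
  have hi : a * a' ≤ 2 ^ m := card_mul_card_compl_le hU hf A
  have ha1 : 1 ≤ a := one_le_card_stab hU' hf A
  -- the spectral mass
  rw [fourFold_eq_spectralMass, Complex.norm_real, Real.norm_eq_abs, abs_of_nonneg
    (mul_nonneg (inv_nonneg.2 (pow_nonneg two_pos.le _))
      (Finset.sum_nonneg fun _ _ => sq_nonneg _)),
    sum_stringsOn_norm_exp_sq_clifford hU hf]
  have hmass := sum_norm_exp_sq_le_card_add m ε hψ hflat
    (Finset.univ.filter fun T : Fin (n + m) → Pauli => f T ∈ stringsOn A)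
  rw [card_filter_data_anc_eq A] at hmass
  -- numerics
  have h2k : (0 : ℝ) < 2 ^ A.card := pow_pos two_pos _
  have h2m : (0 : ℝ) < 2 ^ m := pow_pos two_pos _
  have haR : (1 : ℝ) ≤ a := by exact_mod_cast ha1
  have hiiR : (2 : ℝ) ^ m * b = 4 ^ A.card * a' := by exact_mod_cast hii
  have hiR : (a : ℝ) * a' ≤ 2 ^ m := by exact_mod_cast hi
  have h4 : (4 : ℝ) ^ A.card = 2 ^ A.card * 2 ^ A.card := by
    rw [← mul_pow]; norm_num
  -- b ≤ 4^k a'/2^m ≤ 4^k / a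
  have hbR : (b : ℝ) ≤ 2 ^ A.card * 2 ^ A.card / a := by
    rw [le_div_iff₀ (by linarith), ← h4]
    have : (b : ℝ) * a * 2 ^ m = 4 ^ A.card * (a' * a) := by
      calc (b : ℝ) * a * 2 ^ m = (2 ^ m * b) * a := by ring
        _ = 4 ^ A.card * a' * a := by rw [hiiR]
        _ = 4 ^ A.card * (a' * a) := by ring
    have h4pos : (0 : ℝ) < 4 ^ A.card := pow_pos (by norm_num) _
    nlinarith [this, hiR, h4pos]
  calc (2 ^ A.card)⁻¹ * ∑ T ∈ Finset.univ.filter (fun T : Fin (n + m) → Pauli => f T ∈ stringsOn A),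
        ‖star (tensorVec ψ (zeroState m)) ⬝ᵥ (pauliString T *ᵥ tensorVec ψ (zeroState m))‖ ^ 2
      ≤ (2 ^ A.card)⁻¹ * ((a : ℝ) + ε ^ 2 * b) := by
        exact mul_le_mul_of_nonneg_left hmass (inv_nonneg.2 h2k.le)
    _ ≤ (2 ^ A.card)⁻¹ * ((a : ℝ) + ε ^ 2 * (2 ^ A.card * 2 ^ A.card / a)) := by
        gcongr
    _ = (a : ℝ) / 2 ^ A.card + ε ^ 2 * (2 ^ A.card / a) := by
        field_simp

end Summit.QuantumAdvantage.QuantumAdvantage.Theorems.SymplecticPurity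

end
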